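import Summits.QuantumFields.BalabanUV.T4Continuum.Support.CovariantMeanSupply

/-!
# `T4Continuum.CovariantMeanPaidSupply` (cell-tree module `Summits/QuantumFields/BalabanUV/T4Continuum/Support/CovariantMeanPaidSupply.lean`)
# — road P4 of the spine estimate NE1′: the slots of one step WITH THE PAYING SLOT — a term's birth amplitude may be unbounded
# over terms, so it is paid through an AMPLITUDE-WEIGHTED mass count and the rate slot is term-free
# (cell `pub-balaban`, scoping sub-cell `t4`, ROUND-2 prover seat #4 of BINDER-OWNERS row NE1′, unit `b2b-balaban-t4-ne1p-p4`,
# generation 1; companion of the typed skeleton `t4/skeletons/NE1p-t4-ne1p-p4.md` v1.2 §3 (leaves L5′/L7); ADDITIVE — a new leaf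
# importing `Support/CovariantMeanSupply` (p207717) only; nothing modified — the size lint keeps this out of that file)

HONEST FRAMING.  Finite four-torus, rung (B)+1 only: the `ε → 0` limit of the joint expectations of unit-scale averaged
gauge-invariant Wilson-loop variables on ONE torus of fixed physical size, along a Wilson scheme `D.scheme g₀` of a datum of
Bałaban type `D : T4Continuum.FiniteEpsData F G`.  NOT infinite volume, NOT a mass gap, NOT the Clay problem, NOT summit progress.
HONEST DEPENDENCY: continuum YM on T⁴ ⇐ BetaPertH ∧ nine spine estimates (0/9 proved); BetaPertH ⇐ (D1) ∧ (D4) ∧ CAP+tail;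
G-an2-4 gates asym, D1 and NE2/3/4.  Every analytic input below is a FIELD of a hypothesis structure (`PaidStepSupply`) or a
HYPOTHESIS SHAPE (`PaidSlotSupply`), asserted of NO datum.  STATEMENTS AND QUANTIFIER BOOKKEEPING ONLY; every declaration is
[folklore] and sorry-free.

CITATION HEADER (lean-in-tree rule).  No page of T. Bałaban's series (CMP 1983–89) or of any other source was newly read for this
module; the locators below are CONTEXT for the slot they motivate, not assertions.  Objects re-used BY NAME: `TermRep`,
`loopPullback`, `CovSplit`, `StepCovBudget`, `fibreIntegral`, `rho` (telescoping lineage t4-ne1p-p3), `Factors`,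
`FactorisedCovSupply`, `hasContinuumLimit_of_factorisedCovSupply_midLimits` (p207492), `ladder_le_mul_prod` (p207717),
`MidLimits`, `Missing.HasContinuumLimit`.  ABSOLUTE RULE honoured: no programme-internal statement is a hypothesis-free input; the
literature card `t4/ideate/NE1p/lit-proposed.md` v1.5 (question Q-lit-4) and its HOME kernel annex are cited as PROVENANCE of the
slot change only.

WHY THIS LEAF.  `CovariantMeanSupply.StepSupply` (p207717) asked a term-UNIFORM rate slot `d·∏κb ≤ Cprop·ρⁿ`.  The term's BIRTH
AMPLITUDE `(cs Z).d` — at a complex exterior the un-normalised large-field pair carries `e^{sup_chart|σ(Λ_Z,·)|}` by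
[Balaban1989LargeFieldII] (1.73) p. 380 (tree `B16.ineq173`), whose V(X̃) half is not bounded in print — may be UNBOUNDED over
terms, so it cannot sit there (card's kernel witness `rate_slot_cannot_hold`).  `PaidStepSupply` is the general form: (i) the rate
slot is Z-FREE (`rate : ∏κb ≤ Cprop·ρⁿ`), (ii) `d` stays attached to the term through `ladder_final_le` / `covSize_le`, (iii) the
mass count is split into the AMPLITUDE-WEIGHTED first-order count `massCount₁` — THE PAYING SLOT, where `d` is paid from the term's
own large-field suppression (the cell's WALL §3 item 1(i) at first order, size form; printed TYPE [Balaban1989LargeFieldII]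
(1.79)–(1.88) pp. 384–387, payment NUMBER unprinted) — and the squared-size count `massCount₂` for the second order; `d_nonneg` is
added.  Theorems: `PaidStepSupply.stepCovBudget : PaidStepSupply … k n → StepCovBudget D g₀ Cs (𝔣.budget n) k n`,
`PaidSlotSupply ⇒ FactorisedCovSupply`, `hasContinuumLimit_of_paidSlotSupply_midLimits`.

WHAT IS NOT PROVED / VALUE.  Nothing analytic: no field is instantiated for Bałaban's densities (NODE O has no owner; the block
contraction L8 and the payment number are not in print); `PaidSlotSupply` is asserted of no datum.  Value = the honest placement of
the cell's first-order size wall inside road P4's kernel bookkeeping; NOT summit progress.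
-/

noncomputable section

open MeasureTheory Filter Topology Metric Set
open scoped BigOperators

namespace Summit.QuantumFields.BalabanUV.T4Continuum.CovariantMeanContraction

/-! ## §1 THE PAYING SLOT: a term's birth amplitude may be unbounded over terms, so it is paid through an
AMPLITUDE-WEIGHTED mass count and the rate slot is term-free

Folds the literature card `t4/ideate/NE1p/lit-proposed.md` v1.5, question Q-lit-4 (journal l.5520 / answer l.5601).  The term's
BIRTH AMPLITUDE `(cs Z).d` — at a complex exterior the un-normalised large-field pair carries `e^{sup_chart|σ(Λ_Z,·)|}` by
[Balaban1989LargeFieldII] (1.73) p. 380 (tree `B16.ineq173`), whose V(X̃) half is not bounded in print — may be UNBOUNDED over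
terms, so it cannot sit in the term-uniform rate slot of §1's `StepSupply` (card's kernel witness `rate_slot_cannot_hold`).
`PaidStepSupply` is the general form: (i) the rate slot is Z-FREE (`rate : ∏κb ≤ Cprop·ρⁿ`), (ii) `d` stays attached to the term
through `ladder_final_le` / `covSize_le`, (iii) the mass count is split into the AMPLITUDE-WEIGHTED first-order count `massCount₁`
— THE PAYING SLOT, where `d` is paid from the term's own large-field suppression (the cell's WALL §3 item 1(i) at first order,
size form; printed TYPE [Balaban1989LargeFieldII] (1.79)–(1.88) pp. 384–387, payment NUMBER unprinted) — and the squared-size count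
`massCount₂` for the second order; `d_nonneg` is added.  §1's `StepSupply` (term-uniform amplitude) is kept byte-identical as the
special case; nothing is removed. -/

section Paid

open Literature.MathematicalPhysics.QuantumFieldTheory.Balaban1983to89
open T4Continuum T4ExteriorCovariance T4SummableDefect T4ObservableTelescopeTwoRun T4UniformDefectWiring T4ObservableTelescope
  T4Spectator B15.BasicStep Missing

variable {F : T4Family} {G : Type*} [GaugeGroup G] [MeasurableSpace G] [HaarData G]
variable [∀ K j : ℕ, DecidableEq (PBond (F.P K) j)]

/-- DATA + HYPOTHESES — **THE ROAD'S LEAVES AS SLOTS FOR ONE STEP, WITH THE PAYING SLOT** (v1.1; skeleton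
`t4/skeletons/NE1p-t4-ne1p-p4.md` v1.2 §3; NOT PRINTED, asserted of no datum):
* `ρr`, `cs` — NODE O + leaf L2 (as in `StepSupply`);
* `massCount₁` — leaves L4 + L5 + L5′ (THE PAYING SLOT): Σ_Z mass_Z·|Λ_Z|·d_Z ≤ count × large-field weight × total mass — the
  Z-dependent birth amplitude `d_Z` (leaf L7) is paid HERE from the term's own suppression and nowhere else;
* `massCount₂` — leaves L4 + L5, second-order channel: Σ_Z mass_Z·|Λ_Z|² ≤ count × weight × total mass;
* `sens` (L2), `rem` (L3), `d_nonneg`;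
* the ladder `N`, `κb`, `J` with `birth` (L7: `N Z i 0 ≤ d_Z`), **`contract` (L8: ONE block, ONE functional — the road's declared
  OWN-OPEN piece of NE1′)**, the Z-FREE `rate : ∏κb ≤ Cprop·ρⁿ`, and `final` (L10 + L11). [folklore] -/
structure PaidStepSupply (D : FiniteEpsData F G) (g₀ : ℕ → ℝ) (Cs : List (ULoop F)) (𝔣 : Factors) (k n : ℕ) where
  /-- NODE O: the (0.3)-representation of the realised step -/
  ρr : TermRep (D.real.Trho (k + 1 + n) (g₀ (k + 1 + n)) k) (D.real.R (k + 1 + n) (g₀ (k + 1 + n)) k)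
  /-- NODE O + L2: the first-order split of every term's gap -/
  cs : ∀ Z, CovSplit (ρr.fib Z) (ρr.piece (ρr.pp Z)) (ρr.piece Z) (loopPullback D Cs k n)
  /-- L4 + L5 + L5′ (THE PAYING SLOT): size- and AMPLITUDE-weighted mass count of the new components -/
  massCount₁ : ∑ Z, (∫ V, ρr.piece Z V ∂fieldMeasure (F.P (k + 1 + n)) (k + 1) G) * ((ρr.fib Z).card : ℝ) * (cs Z).d
      ≤ 𝔣.cnt * 𝔣.Λ₄ ^ n * 𝔣.w n *
        ∫ V, rho D (k + 1 + n) (g₀ (k + 1 + n)) (k + 1 + n) V ∂fieldMeasure (F.P (k + 1 + n)) (k + 1 + n) G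
  /-- L4 + L5 (second-order channel): squared-size-weighted mass count of the new components -/
  massCount₂ : ∑ Z, (∫ V, ρr.piece Z V ∂fieldMeasure (F.P (k + 1 + n)) (k + 1) G) * ((ρr.fib Z).card : ℝ) ^ 2
      ≤ 𝔣.cnt * 𝔣.Λ₄ ^ n * 𝔣.w n *
        ∫ V, rho D (k + 1 + n) (g₀ (k + 1 + n)) (k + 1 + n) V ∂fieldMeasure (F.P (k + 1 + n)) (k + 1 + n) G
  /-- L2: the split's total sensitivity -/
  sens : ∀ Z, (Fintype.card (cs Z).κ : ℝ) * (cs Z).θ ≤ 𝔣.Csens * 𝔣.θ₁ ^ n * ((ρr.fib Z).card : ℝ)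
  /-- L3: the second-order remainder -/
  rem : ∀ Z, (cs Z).remSize
      ≤ (∫ V, ρr.piece Z V ∂fieldMeasure (F.P (k + 1 + n)) (k + 1) G) * (𝔣.C₂ * (𝔣.θ₁ ^ n) ^ 2 * ((ρr.fib Z).card : ℝ) ^ 2)
  /-- number of propagation blocks between the step and the unit scale -/
  J : ℕ
  /-- the propagation ladder: sup norms of the propagated local covariant factor after `j` blocks -/
  N : ∀ Z, (cs Z).κ → ℕ → ℝ
  /-- the block rates -/
  κb : ℕ → ℝ
  /-- the amplitudes are nonnegative -/
  d_nonneg : ∀ Z, 0 ≤ (cs Z).d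
  /-- the block rates are nonnegative -/
  κb_nonneg : ∀ j, 0 ≤ κb j
  /-- L7: birth bound (by the term's amplitude = the split's shift bound) -/
  birth : ∀ Z i, N Z i 0 ≤ (cs Z).d
  /-- **L8: the block contraction** -/
  contract : ∀ Z i j, N Z i (j + 1) ≤ κb j * N Z i j
  /-- Z-FREE rate bookkeeping: product of block rates ≤ `Cprop·ρⁿ` -/
  rate : ∏ j ∈ Finset.range J, κb j ≤ 𝔣.Cprop * 𝔣.ρ ^ n
  /-- L10 + L11: the final pairing -/
  final : ∀ Z i, |∫ V, fibreIntegral (ρr.fib Z) (ρr.piece Z) V * ((cs Z).Ω i V * (cs Z).S i V)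
      ∂fieldMeasure (F.P (k + 1 + n)) (k + 1) G|
      ≤ (cs Z).θ * (∫ V, ρr.piece Z V ∂fieldMeasure (F.P (k + 1 + n)) (k + 1) G) * N Z i J * 𝔣.Cfin

namespace PaidStepSupply

variable {D : FiniteEpsData F G} {g₀ : ℕ → ℝ} {Cs : List (ULoop F)} {𝔣 : Factors} {k n : ℕ}
variable (σ : PaidStepSupply D g₀ Cs 𝔣 k n)

/-- Along the ladder: `N_J ≤ d·∏κb ≤ d·Cprop·ρⁿ` (the amplitude stays attached to the term). [folklore] -/
theorem ladder_final_le (Z : σ.ρr.ι) (i : (σ.cs Z).κ) : σ.N Z i σ.J ≤ (σ.cs Z).d * (𝔣.Cprop * 𝔣.ρ ^ n) := by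
  have h1 := ladder_le_mul_prod σ.κb_nonneg (fun j => σ.contract Z i j) σ.J
  have hprod : 0 ≤ ∏ j ∈ Finset.range σ.J, σ.κb j := Finset.prod_nonneg fun j _ => σ.κb_nonneg j
  exact h1.trans ((mul_le_mul_of_nonneg_right (σ.birth Z i) hprod).trans
    (mul_le_mul_of_nonneg_left σ.rate (σ.d_nonneg Z)))

/-- **ONE TERM'S COVARIANCE SIZE**: `covSize_Z ≤ ∫m_Z · Csens·θ₁ⁿ·|Λ_Z| · d_Z · Cprop·ρⁿ · Cfin`. [folklore] -/
theorem covSize_le (Z : σ.ρr.ι) : (σ.cs Z).covSize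
    ≤ (∫ V, σ.ρr.piece Z V ∂fieldMeasure (F.P (k + 1 + n)) (k + 1) G) *
      (𝔣.Csens * 𝔣.θ₁ ^ n * ((σ.ρr.fib Z).card : ℝ)) * (σ.cs Z).d * (𝔣.Cprop * 𝔣.ρ ^ n) * 𝔣.Cfin := by
  have hm : 0 ≤ ∫ V, σ.ρr.piece Z V ∂fieldMeasure (F.P (k + 1 + n)) (k + 1) G :=
    integral_nonneg (σ.ρr.provisos Z).old_nonneg
  have hCf := 𝔣.Cfin_nonneg
  have hi : ∀ i ∈ (Finset.univ : Finset (σ.cs Z).κ),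
      |∫ V, fibreIntegral (σ.ρr.fib Z) (σ.ρr.piece Z) V * ((σ.cs Z).Ω i V * (σ.cs Z).S i V)
        ∂fieldMeasure (F.P (k + 1 + n)) (k + 1) G|
      ≤ (σ.cs Z).θ * (∫ V, σ.ρr.piece Z V ∂fieldMeasure (F.P (k + 1 + n)) (k + 1) G) *
        ((σ.cs Z).d * (𝔣.Cprop * 𝔣.ρ ^ n)) * 𝔣.Cfin := by
    intro i _
    refine (σ.final Z i).trans ?_
    have hθ : 0 ≤ (σ.cs Z).θ := (abs_nonneg _).trans ((σ.cs Z).Ω_le i default)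
    have hw : 0 ≤ (σ.cs Z).θ * ∫ V, σ.ρr.piece Z V ∂fieldMeasure (F.P (k + 1 + n)) (k + 1) G := mul_nonneg hθ hm
    exact mul_le_mul_of_nonneg_right (mul_le_mul_of_nonneg_left (σ.ladder_final_le Z i) hw) hCf
  have hsum := Finset.sum_le_sum hi
  rw [Finset.sum_const, Finset.card_univ, nsmul_eq_mul] at hsum
  refine hsum.trans ?_
  have hrest : 0 ≤ (∫ V, σ.ρr.piece Z V ∂fieldMeasure (F.P (k + 1 + n)) (k + 1) G) *
      ((σ.cs Z).d * (𝔣.Cprop * 𝔣.ρ ^ n)) * 𝔣.Cfin :=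
    mul_nonneg (mul_nonneg hm (mul_nonneg (σ.d_nonneg Z) (mul_nonneg 𝔣.Cprop_nonneg (pow_nonneg 𝔣.ρ_nonneg n)))) hCf
  calc (Fintype.card (σ.cs Z).κ : ℝ) * ((σ.cs Z).θ * (∫ V, σ.ρr.piece Z V ∂fieldMeasure (F.P (k + 1 + n)) (k + 1) G) *
        ((σ.cs Z).d * (𝔣.Cprop * 𝔣.ρ ^ n)) * 𝔣.Cfin)
      = ((Fintype.card (σ.cs Z).κ : ℝ) * (σ.cs Z).θ) *
          ((∫ V, σ.ρr.piece Z V ∂fieldMeasure (F.P (k + 1 + n)) (k + 1) G) * ((σ.cs Z).d * (𝔣.Cprop * 𝔣.ρ ^ n)) *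
            𝔣.Cfin) := by ring
    _ ≤ (𝔣.Csens * 𝔣.θ₁ ^ n * ((σ.ρr.fib Z).card : ℝ)) *
          ((∫ V, σ.ρr.piece Z V ∂fieldMeasure (F.P (k + 1 + n)) (k + 1) G) * ((σ.cs Z).d * (𝔣.Cprop * 𝔣.ρ ^ n)) *
            𝔣.Cfin) := mul_le_mul_of_nonneg_right (σ.sens Z) hrest
    _ = _ := by ring

/-- **THE PAID SLOTS CLOSE ONE STEP: `PaidStepSupply ⇒ StepCovBudget D g₀ Cs (𝔣.budget n) k n`** — first-order channel against
the amplitude-weighted count `massCount₁`, second-order channel against `massCount₂`. [folklore] -/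
theorem stepCovBudget (σ : PaidStepSupply D g₀ Cs 𝔣 k n) : StepCovBudget D g₀ Cs (𝔣.budget n) k n := by
  refine ⟨σ.ρr, σ.cs, ?_⟩
  set I : ℝ := ∫ V, rho D (k + 1 + n) (g₀ (k + 1 + n)) (k + 1 + n) V ∂fieldMeasure (F.P (k + 1 + n)) (k + 1 + n) G with hI
  have hA : 0 ≤ 𝔣.Csens * 𝔣.θ₁ ^ n * (𝔣.Cprop * 𝔣.ρ ^ n) * 𝔣.Cfin :=
    mul_nonneg (mul_nonneg (mul_nonneg 𝔣.Csens_nonneg (pow_nonneg 𝔣.θ₁_nonneg n))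
      (mul_nonneg 𝔣.Cprop_nonneg (pow_nonneg 𝔣.ρ_nonneg n))) 𝔣.Cfin_nonneg
  have hB : 0 ≤ 𝔣.C₂ * (𝔣.θ₁ ^ n) ^ 2 := mul_nonneg 𝔣.C₂_nonneg (sq_nonneg _)
  have h1 : ∀ Z ∈ (Finset.univ : Finset σ.ρr.ι), (σ.cs Z).covSize
      ≤ 𝔣.Csens * 𝔣.θ₁ ^ n * (𝔣.Cprop * 𝔣.ρ ^ n) * 𝔣.Cfin *
        ((∫ V, σ.ρr.piece Z V ∂fieldMeasure (F.P (k + 1 + n)) (k + 1) G) * ((σ.ρr.fib Z).card : ℝ) * (σ.cs Z).d) := by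
    intro Z _
    refine (σ.covSize_le Z).trans (le_of_eq ?_)
    ring
  have h2 : ∀ Z ∈ (Finset.univ : Finset σ.ρr.ι), (σ.cs Z).remSize
      ≤ 𝔣.C₂ * (𝔣.θ₁ ^ n) ^ 2 *
        ((∫ V, σ.ρr.piece Z V ∂fieldMeasure (F.P (k + 1 + n)) (k + 1) G) * ((σ.ρr.fib Z).card : ℝ) ^ 2) := by
    intro Z _
    refine (σ.rem Z).trans (le_of_eq ?_)
    ring
  have hs1 := Finset.sum_le_sum h1
  have hs2 := Finset.sum_le_sum h2
  rw [← Finset.mul_sum] at hs1 hs2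
  rw [Finset.sum_add_distrib]
  calc ∑ Z, (σ.cs Z).covSize + ∑ Z, (σ.cs Z).remSize
      ≤ 𝔣.Csens * 𝔣.θ₁ ^ n * (𝔣.Cprop * 𝔣.ρ ^ n) * 𝔣.Cfin * (𝔣.cnt * 𝔣.Λ₄ ^ n * 𝔣.w n * I)
        + 𝔣.C₂ * (𝔣.θ₁ ^ n) ^ 2 * (𝔣.cnt * 𝔣.Λ₄ ^ n * 𝔣.w n * I) :=
        add_le_add (hs1.trans (mul_le_mul_of_nonneg_left σ.massCount₁ hA))
          (hs2.trans (mul_le_mul_of_nonneg_left σ.massCount₂ hB))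
    _ = 𝔣.budget n * I := by rw [Factors.budget]; ring

end PaidStepSupply

/-- HYPOTHESIS SHAPE — **THE ROAD'S LEAVES WITH THE PAYING SLOT, AT EVERY STEP** (v1.1): per string there are `Factors` such that
every step at every distance admits a `PaidStepSupply`.  NOT PRINTED, asserted of no datum. [folklore] -/
def PaidSlotSupply (D : FiniteEpsData F G) (g₀ : ℕ → ℝ) : Prop :=
  ∀ Cs : List (ULoop F), ∃ 𝔣 : Factors, ∀ k n, Nonempty (PaidStepSupply D g₀ Cs 𝔣 k n)

/-- **`PaidSlotSupply ⇒ FactorisedCovSupply`** (step by step). [folklore] -/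
theorem factorisedCovSupply_of_paidSlotSupply (D : FiniteEpsData F G) (g₀ : ℕ → ℝ) (h : PaidSlotSupply D g₀) :
    FactorisedCovSupply D g₀ := by
  intro Cs
  obtain ⟨𝔣, hkn⟩ := h Cs
  exact ⟨𝔣, fun k n => (hkn k n).elim fun σ => σ.stepCovBudget⟩

/-- **END-TO-END FROM THE PAID SLOTS**: `PaidSlotSupply ∧ MidLimits ⇒ Missing.HasContinuumLimit (D.scheme g₀)`.  CONDITIONAL on
both shapes; rung (B)+1 on the finite torus only. [folklore] -/
theorem hasContinuumLimit_of_paidSlotSupply_midLimits [RegularGaugeGroup G] (D : FiniteEpsData F G) (hM : D.AvgMeasurable)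
    (g₀ : ℕ → ℝ) (h : PaidSlotSupply D g₀) (hL : MidLimits D g₀) : HasContinuumLimit (D.scheme g₀) :=
  hasContinuumLimit_of_factorisedCovSupply_midLimits D hM g₀ (factorisedCovSupply_of_paidSlotSupply D g₀ h) hL

end Paid

end Summit.QuantumFields.BalabanUV.T4Continuum.CovariantMeanContraction
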